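import Literature.NumberTheory.LFunctions.VerjovskyTheoremAProofs
import Literature.NumberTheory.LFunctions.VerjovskyCriterionSufficiencyProofs
import Literature.NumberTheory.LFunctions.HorocycleZeroModeQuasiRH
import HarnessLib

/-!
RH-EQUIVALENT (Verjovsky's Theorem B for the test class `C_c³(ℝ₊ˣ)`, both directions PROVED;
nothing here bears on the truth of RH). # Verjovsky 1994, Theorem B with `r = 3`

Verjovsky states Theorem B for the classes `C_c^r(ℝ₊ˣ)`, `r ≥ 2` (Kodai Math. J. 17 (1994), Thm B
p. 597, §3 p. 603). The tree's named facts `Verjovsky1994_thmB1/B2`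
(`VerjovskyDiscreteMeasures.lean`) print the case `r = 2`; their sufficiency halves are PROVED in
`VerjovskyCriterionSufficiencyProofs.lean` for every `r`. This file PROVES the necessity halves
for `r = 3` and hence Theorem B with `r = 3` as kernel equivalences:

* `Literature.NumberTheory.LFunctions.VerjovskyCriterion.verjovskyRate_of_quasiRH_of_contDiff_three`
  — if `ζ(s) ≠ 0` for `θ₀ < re s < 1` (`1/2 ≤ θ₀ < 1`), then for every `f ∈ C_c³(ℝ₊ˣ)` and
  `ε > 0`, `m_y(f) − m₀(f) = O(y^{1−θ₀/2−ε})` at `0⁺` (Thm B 2), second half, with `r = 3`);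
* `Literature.NumberTheory.LFunctions.verjovsky_thmB2_iff_of_contDiff_three` — for
  `1/2 < α < 3/4`: `ζ ≠ 0` on `re s > 2(1−α)` **iff** `m_y(f) − m₀(f) = O(y^{α−ε})` for all
  `f ∈ C_c³(ℝ₊ˣ)`, all `ε > 0`;
* `Literature.NumberTheory.LFunctions.verjovsky_thmB1_iff_of_contDiff_three` —
  **RH iff** `m_y(f) − m₀(f) = o(y^{3/4−ε})` for all `f ∈ C_c³(ℝ₊ˣ)`, all `ε > 0`.

-- TODO(general form): the printed class `C_c²` (the facts `Verjovsky1994_thmB1/B2`). Verjovsky's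
necessity proof goes through Mellin inversion and needs `1/ζ(σ+it) ≪ |t|^ε` to the right of the
zero-free abscissa (Littlewood; not in the tree); the elementary road below needs one more
derivative (`C³`) — exactly as in the tree's horocycle files (`HorocycleZeroModeRate`,
`HorocycleZeroModeQuasiRH`), whose zero-mode lemma we apply.

## Proof of the necessity half (elementary; not Verjovsky's)

With `l = √y`, `k(u) = u f(u)` (`C³`, `k = 0` on `[R,∞)`): `m_y(f) = l Σ_c (φ(c)/c) k(lc)`
(`VerjovskyTheoremA.verjovskyMeasure_eq_mul_sum`), `m₀(f) = (Σ_d μ(d)/d²) ∫₀^R k`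
(`VerjovskyTheoremA.verjovskyMean_eq`), and under `|M(t)| ≤ C t^α` (`α = θ₀ + 2ε' < 1`, from
quasi-RH by the tree's `MoebiusDilatedSums.exists_mertens_bound_of_quasiRH`, Titchmarsh 14.25)
the tree's power-saving zero-mode lemma `HorocycleZeroModeQuasiRH.zeroMode_bound_rpow` gives
`Σ_c (φ(c)/c) k(lc) = (Σ_d μ(d)/d²)(∫k)/l + O(l^{1−α})`; multiplying by `l`:
`m_y(f) − m₀(f) = O(l^{2−α}) = O(y^{1−θ₀/2−ε'})`.

## References

* A. Verjovsky, *Discrete measures and the Riemann hypothesis*, Kodai Math. J. 17 (1994)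
  596–608, Thm B p. 597, §3 p. 603 [Verjovsky1994].
* D. Zagier, *Eisenstein series and the Riemann zeta function* (1981), §1 (Z1) [Zagier1981].

## Mathlib / tree search

Tree: `HorocycleZeroModeQuasiRH.zeroMode_bound_rpow`, `MoebiusDilatedSums.exists_mertens_bound_of_quasiRH`,
`VerjovskyTheoremA.verjovskyMeasure_eq_mul_sum`, `VerjovskyTheoremA.verjovskyMean_eq`,
`VerjovskyCriterion.riemannZeta_ne_zero_of_verjovskyRate_of_class`,
`quasiRiemannHypothesis_one_half_iff_holds`. Mathlib: `Real.rpow_le_rpow_of_exponent_ge`,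
`Asymptotics.IsBigO.trans_isLittleO`.
-/

noncomputable section

open Real Complex MeasureTheory Set Filter Asymptotics Topology

open scoped ArithmeticFunction.Moebius

namespace Literature.NumberTheory.LFunctions

namespace VerjovskyCriterion

/-- `y^a = o(y^b)` at `0⁺` for `b < a`. [folklore] -/
private theorem rpow_isLittleO_rpow_nhdsGT {a b : ℝ} (hab : b < a) :
    (fun y : ℝ ↦ y ^ a) =o[𝓝[>] 0] fun y : ℝ ↦ y ^ b := by
  refine isLittleO_iff.2 fun c hc ↦ ?_
  have hab' : 0 < a - b := by linarith
  have hδ : 0 < c ^ (1 / (a - b)) := Real.rpow_pos_of_pos hc _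
  filter_upwards [Ioo_mem_nhdsGT hδ] with y hy
  obtain ⟨hy0, hy1⟩ := hy
  rw [Real.norm_of_nonneg (Real.rpow_nonneg hy0.le _),
    Real.norm_of_nonneg (Real.rpow_nonneg hy0.le _)]
  have hsplit : y ^ a = y ^ (a - b) * y ^ b := by
    rw [← Real.rpow_add hy0]; ring_nf
  rw [hsplit]
  have hyb : 0 ≤ y ^ b := Real.rpow_nonneg hy0.le _
  have hle : y ^ (a - b) ≤ c := by
    calc y ^ (a - b) ≤ (c ^ (1 / (a - b))) ^ (a - b) :=
          Real.rpow_le_rpow hy0.le hy1.le hab'.le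
      _ = c := by
          rw [← Real.rpow_mul hc.le, one_div_mul_cancel hab'.ne', Real.rpow_one]
  exact mul_le_mul_of_nonneg_right hle hyb

/-- **Verjovsky's Theorem B 2), second half, for `C_c³` test functions** ("Conversely, if the
Riemann zeta-function has no zeroes in the half-plane `Re(s) > 2(1−α)` then (3) holds for all
functions `f ∈ C_c^r(ℝ*)`", here `r = 3`): if `ζ(s) ≠ 0` for `θ₀ < re s < 1` (`1/2 ≤ θ₀ < 1`)
then `m_y(f) − m₀(f) = O(y^{1−θ₀/2−ε})` at `0⁺` for every `f ∈ C_c³(ℝ₊ˣ)` and every `ε > 0`.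
Elementary proof via the tree's power-saving zero-mode lemma (see the module docstring).
[cite: Verjovsky1994, Thm B 2) p. 597 (second half; classes C_c^r, §3 p. 603)] -/
theorem verjovskyRate_of_quasiRH_of_contDiff_three {θ₀ : ℝ} (h0 : 1 / 2 ≤ θ₀) (h1 : θ₀ < 1)
    (hQ : QuasiRiemannHypothesis θ₀) {f : ℝ → ℂ} (hf : IsVerjovskyTest 3 f) {ε : ℝ}
    (hε : 0 < ε) :
    (fun y : ℝ ↦ verjovskyMeasure y f - verjovskyMean f) =O[𝓝[>] 0]
      fun y : ℝ ↦ y ^ (1 - θ₀ / 2 - ε) := by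
  obtain ⟨hcd, hcs, -⟩ := hf
  have hfc : Continuous f := hcd.continuous
  -- a small `ε'` so that `α = θ₀ + 2ε' < 1`
  set ε' : ℝ := min ε ((1 - θ₀) / 4) with hε'
  have hε'0 : 0 < ε' := lt_min hε (by linarith)
  have hε'ε : ε' ≤ ε := min_le_left _ _
  have hε'1 : ε' ≤ (1 - θ₀) / 4 := min_le_right _ _
  set α : ℝ := θ₀ + 2 * ε' with hα
  have hα0 : 0 < α := by rw [hα]; linarith
  have hα1 : α < 1 := by rw [hα]; linarith
  obtain ⟨CM, hCM0, hM⟩ :=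
    MoebiusDilatedSums.exists_mertens_bound_of_quasiRH h0 h1 hQ (ε := 2 * ε') (by linarith)
  -- the support bound `R ≥ 1`
  obtain ⟨r, hr⟩ := (hcs.isCompact.isBounded).subset_closedBall (0 : ℝ)
  set R : ℝ := max r 0 + 1 with hRdef
  have hR0 : 0 < R := by rw [hRdef]; linarith [le_max_right r 0]
  have hfR : ∀ s, R ≤ s → f s = 0 := by
    intro s hs
    refine image_eq_zero_of_notMem_tsupport fun hmem ↦ ?_
    have h1 := hr hmem
    rw [Metric.mem_closedBall, dist_zero_right, Real.norm_eq_abs] at h1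
    have : s ≤ r := (le_abs_self s).trans h1
    linarith [le_max_left r 0]
  -- `k(u) = u f(u)` is `C³` and vanishes on `[R, ∞)`
  set k : ℝ → ℂ := fun u ↦ (u : ℂ) * f u with hkdef
  have hofReal : ContDiff ℝ 3 (fun u : ℝ ↦ (u : ℂ)) := ofRealCLM.contDiff
  have hk : ContDiff ℝ 3 k := hofReal.mul hcd
  have hkR : ∀ s, R ≤ s → k s = 0 := fun s hs ↦ by
    simp only [hkdef, hfR s hs, mul_zero]
  obtain ⟨C, hC⟩ := HorocycleZeroModeQuasiRH.zeroMode_bound_rpow hk hR0 hkR hCM0 hα0 hα1 hM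
  set I : ℂ := ∫ s in (0 : ℝ)..R, k s with hI
  set S : ℂ := ∑' d : ℕ, (μ d : ℂ) / (d : ℂ) ^ 2 with hS
  have hmean : verjovskyMean f = S * I := VerjovskyTheoremA.verjovskyMean_eq hfc hR0.le hfR
  have hC0 : 0 ≤ max C 0 := le_max_right _ _
  refine IsBigO.of_bound (max C 0) ?_
  have hy₀ : 0 < min 1 ((R / 2) ^ 2) := lt_min one_pos (by positivity)
  filter_upwards [Ioo_mem_nhdsGT hy₀] with y hy
  obtain ⟨hy0, hy1⟩ := hy
  have hy1' : y < 1 := lt_of_lt_of_le hy1 (min_le_left _ _)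
  have hyR : y < (R / 2) ^ 2 := lt_of_lt_of_le hy1 (min_le_right _ _)
  set l : ℝ := Real.sqrt y with hl
  have hl0 : 0 < l := Real.sqrt_pos.2 hy0
  have hlR : l ≤ R / 2 := by
    have h := Real.sqrt_lt_sqrt hy0.le hyR
    rw [Real.sqrt_sq (by positivity)] at h
    exact h.le
  -- `N` capturing the support
  set N : ℕ := ⌈R / l⌉₊ with hN
  have hNR : R ≤ l * N := by
    have : R / l ≤ N := Nat.le_ceil _
    rwa [div_le_iff₀' hl0] at this
  have hmeas := VerjovskyTheoremA.verjovskyMeasure_eq_mul_sum hfR hy0 hNR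
  have hcore := hC l hl0 hlR N hNR
  have hlc : (l : ℂ) ≠ 0 := by exact_mod_cast hl0.ne'
  have hdiff : verjovskyMeasure y f - verjovskyMean f =
      (l : ℂ) * (∑ c ∈ Finset.Ioc 0 N, ((Nat.totient c : ℂ) / c) * k (l * c) - S * I / l) := by
    rw [hmeas, hmean, mul_sub, mul_div_cancel₀ _ hlc]
  rw [hdiff, norm_mul, Complex.norm_real, Real.norm_of_nonneg hl0.le,
    Real.norm_of_nonneg (Real.rpow_nonneg hy0.le _)]
  -- `l · l^{1-α} = y^{1 - θ₀/2 - ε'} ≤ y^{1 - θ₀/2 - ε}`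
  have hexp : l * l ^ (1 - α) = y ^ (1 - θ₀ / 2 - ε') := by
    have e1 : l * l ^ (1 - α) = l ^ (2 - α) := by
      rw [show (2 : ℝ) - α = 1 + (1 - α) by ring, Real.rpow_add hl0, Real.rpow_one]
    rw [e1, hl, Real.sqrt_eq_rpow, ← Real.rpow_mul hy0.le]
    congr 1
    rw [hα]; ring
  have hmono : y ^ (1 - θ₀ / 2 - ε') ≤ y ^ (1 - θ₀ / 2 - ε) :=
    Real.rpow_le_rpow_of_exponent_ge hy0 hy1'.le (by linarith)
  have hl1α : 0 ≤ l ^ (1 - α) := Real.rpow_nonneg hl0.le _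
  calc l * ‖∑ c ∈ Finset.Ioc 0 N, ((Nat.totient c : ℂ) / c) * k (l * c) - S * I / l‖
      ≤ l * (C * l ^ (1 - α)) := mul_le_mul_of_nonneg_left hcore hl0.le
    _ ≤ l * (max C 0 * l ^ (1 - α)) := by gcongr; exact le_max_left _ _
    _ = max C 0 * y ^ (1 - θ₀ / 2 - ε') := by rw [← hexp]; ring
    _ ≤ max C 0 * y ^ (1 - θ₀ / 2 - ε) := by gcongr

end VerjovskyCriterion

open VerjovskyCriterion in
/-- **Verjovsky 1994, Theorem B 2) with `r = 3`**, PROVED as an equivalence: for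
`1/2 < α < 3/4`, `ζ(s) ≠ 0` for `re s > 2(1−α)` iff `m_y(f) − m₀(f) = O(y^{α−ε})` at `0⁺` for
every `f ∈ C_c³(ℝ₊ˣ)` and every `ε > 0`. [cite: Verjovsky1994, Thm B 2) p. 597 (classes C_c^r, r ≥ 2; here r = 3)] -/
theorem verjovsky_thmB2_iff_of_contDiff_three {α : ℝ} (hα1 : 1 / 2 < α) (hα2 : α < 3 / 4) :
    (∀ s : ℂ, 2 * (1 - α) < s.re → riemannZeta s ≠ 0) ↔
      ∀ f : ℝ → ℂ, IsVerjovskyTest 3 f → ∀ ε : ℝ, 0 < ε →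
        (fun y : ℝ ↦ verjovskyMeasure y f - verjovskyMean f) =O[𝓝[>] 0]
          fun y : ℝ ↦ y ^ (α - ε) := by
  constructor
  · intro hZ f hf ε hε
    have hQ : QuasiRiemannHypothesis (2 * (1 - α)) := fun s hs h1 _ ↦ hZ s h1 hs
    have h := verjovskyRate_of_quasiRH_of_contDiff_three (θ₀ := 2 * (1 - α)) (by linarith)
      (by linarith) hQ hf hε
    have e : 1 - 2 * (1 - α) / 2 - ε = α - ε := by ring
    rwa [e] at h
  · intro h s hs
    exact riemannZeta_ne_zero_of_verjovskyRate_of_class 3 (by linarith) (by linarith) h hs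

open VerjovskyCriterion in
/-- **Verjovsky 1994, Theorem B 1) with `r = 3`**, PROVED as an equivalence: the Riemann
Hypothesis holds iff `m_y(f) − m₀(f) = o(y^{3/4−ε})` at `0⁺` for every `f ∈ C_c³(ℝ₊ˣ)` and every
`ε > 0`. [cite: Verjovsky1994, Thm B 1) p. 597 (classes C_c^r, r ≥ 2; here r = 3)] -/
theorem verjovsky_thmB1_iff_of_contDiff_three :
    RiemannHypothesis ↔
      ∀ f : ℝ → ℂ, IsVerjovskyTest 3 f → ∀ ε : ℝ, 0 < ε →
        (fun y : ℝ ↦ verjovskyMeasure y f - verjovskyMean f) =o[𝓝[>] 0]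
          fun y : ℝ ↦ y ^ (3 / 4 - ε) := by
  constructor
  · intro hRH f hf ε hε
    have hQ : QuasiRiemannHypothesis (1 / 2) := quasiRiemannHypothesis_one_half_iff_holds.2 hRH
    have h := verjovskyRate_of_quasiRH_of_contDiff_three (θ₀ := 1 / 2) le_rfl (by norm_num) hQ
      hf (ε := ε / 2) (by linarith)
    have e : 1 - 1 / 2 / 2 - ε / 2 = 3 / 4 - ε / 2 := by ring
    rw [e] at h
    exact h.trans_isLittleO (VerjovskyCriterion.rpow_isLittleO_rpow_nhdsGT (by linarith))
  · intro h
    refine quasiRiemannHypothesis_one_half_iff_holds.1 fun s hs h1 _ ↦ ?_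
    exact riemannZeta_ne_zero_of_verjovskyRate_of_class 3 (α := 3 / 4) (by norm_num)
      (by norm_num) (fun f hf ε hε ↦ (h f hf ε hε).isBigO) (by linarith) hs

end Literature.NumberTheory.LFunctions
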